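import Literature.Probability.LatticeModels.DominationFromNoBadPercolation
import Literature.Probability.LatticeModels.ProductTailTriviality
import Literature.Probability.LatticeModels.LineTouchingIO
import Literature.Probability.LatticeModels.InfiniteClusterTail
import Literature.Probability.LatticeModels.TailTrivialGibbs
import Literature.Probability.LatticeModels.WallLimitState
import HarnessLib

/-!
# The duplicated system: bad-cluster tail events and positive correlations (GH2000, L5.5)

Topic `Probability/LatticeModels`. Two measure-theoretic inputs of Georgii–Higuchi 2000, end of
the proof of Lemma 5.5 (p. 16), for the duplicated system `ν̂ = μ ⊗ μ̂`:

* "Since this event is measurable with respect to the product-tail `𝒯⁽²⁾` on which `ν̂` is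
  trivial, the lemma follows": the event "there is an infinite lattice cluster of bad sites
  `{ω = +1, ω̂ = -1}`" is a product-tail event (`measurableSet_prodTailEvents_existsInfBadCluster`),
  hence has `ν̂`-probability `0` or `1` for tail-trivial `μ, μ̂`
  (`measure_existsInfBadCluster_eq_zero_or_one`), and a uniform positive lower bound on the
  probability of its complement forces it to be null (`ae_no_bad_percolation_of_measure_compl_pos`);
* "The indicator functions of these events can be written as increasing functions `f` resp. `g`
  of the difference configuration `ω̂ − ω`. Using the positive correlations of `μ̂` and `μ` we
  thus obtain `ν̂(A ∩ B) ≥ ν̂(A) ν̂(B)`": **`prod_measure_inter_ge`** for events increasing in `ω̂`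
  and decreasing in `ω`, from the FKG inequality of tail-trivial Ising Gibbs measures
  (`isingGibbs_integral_mul_ge_of_isTailTrivial`) and Fubini.

## References

* H.-O. Georgii, Y. Higuchi, J. Math. Phys. 41 (2000), proof of Lemma 5.5 (p. 16) and of
  Lemma 5.4 (p. 14) [GeorgiiHiguchi2000].
-/

noncomputable section

open MeasureTheory Filter Finset
open Literature.Probability.Percolation
open scoped ENNReal

namespace Literature.Probability.LatticeModels

/-! ### The bad-cluster event is a product-tail event -/

section Tail

/-- The bad configuration with a finite set `Λ` frozen to good. [folklore] -/
def badConfigOff (Λ : Finset (Site 2)) (p : SpinConfig (Site 2) × SpinConfig (Site 2)) : SpinConfig (Site 2) :=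
  fun z => if z ∈ Λ then -1 else badConfig p z

/-- Its `+`sites are the bad sites off `Λ`. [folklore] -/
theorem spinSites_badConfigOff (Λ : Finset (Site 2)) (p : SpinConfig (Site 2) × SpinConfig (Site 2)) :
    spinSites 1 (badConfigOff Λ p) = spinSites 1 (badConfig p) \ ↑Λ := by
  ext z
  simp only [mem_spinSites, badConfigOff, Set.mem_sdiff, Finset.mem_coe]
  by_cases hz : z ∈ Λ <;> simp [hz]

/-- `badConfigOff Λ` is measurable from `𝓕_{Λᶜ} ⊗ 𝓕_{Λᶜ}`. [folklore] -/
theorem measurable_badConfigOff (Λ : Finset (Site 2)) :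
    Measurable[(cylinderEvents (X := fun _ : Site 2 => ℤˣ) ((↑Λ : Set (Site 2))ᶜ)).prod
      (cylinderEvents (X := fun _ : Site 2 => ℤˣ) ((↑Λ : Set (Site 2))ᶜ)), MeasurableSpace.pi] (badConfigOff Λ) := by
  letI m : MeasurableSpace (SpinConfig (Site 2)) := cylinderEvents (X := fun _ : Site 2 => ℤˣ) ((↑Λ : Set (Site 2))ᶜ)
  letI mp : MeasurableSpace (SpinConfig (Site 2) × SpinConfig (Site 2)) := m.prod m
  refine @measurable_pi_lambda _ _ _ mp _ _ fun z => ?_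
  by_cases hz : z ∈ Λ
  · have : (fun p : SpinConfig (Site 2) × SpinConfig (Site 2) => badConfigOff Λ p z) = fun _ => -1 := by
      funext p; simp [badConfigOff, hz]
    rw [this]; exact @measurable_const _ _ _ mp _
  · have hz' : z ∈ ((↑Λ : Set (Site 2))ᶜ) := fun h => hz (Finset.mem_coe.1 h)
    have h1 : Measurable[mp] fun p : SpinConfig (Site 2) × SpinConfig (Site 2) => p.1 z :=
      (measurable_cylinderEvent_apply (X := fun _ : Site 2 => ℤˣ) hz').comp (@measurable_fst _ _ m m)
    have h2 : Measurable[mp] fun p : SpinConfig (Site 2) × SpinConfig (Site 2) => p.2 z :=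
      (measurable_cylinderEvent_apply (X := fun _ : Site 2 => ℤˣ) hz').comp (@measurable_snd _ _ m m)
    have h12 : Measurable[mp] fun p : SpinConfig (Site 2) × SpinConfig (Site 2) => (p.1 z, p.2 z) :=
      @Measurable.prodMk _ mp _ _ _ _ _ _ h1 h2
    have heq : (fun p : SpinConfig (Site 2) × SpinConfig (Site 2) => badConfigOff Λ p z) =
        (fun q : ℤˣ × ℤˣ => if q.1 = 1 ∧ q.2 = -1 then (1 : ℤˣ) else -1) ∘ fun p => (p.1 z, p.2 z) := by
      funext p; simp [badConfigOff, hz, badConfig]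
    rw [heq]
    exact (measurable_of_countable _).comp h12

/-- **The event "an infinite lattice cluster of bad sites exists" is a product-tail event**
(changing finitely many sites does not affect it: `exists_infinite_siteCluster_sdiff`). [cite: GeorgiiHiguchi2000, Lemma 5.5 (proof, p. 16)] -/
theorem measurableSet_prodTailEvents_existsInfBadCluster :
    MeasurableSet[prodTailEvents (Site 2) ℤˣ] {p : SpinConfig (Site 2) × SpinConfig (Site 2) |
      ∃ t, (siteCluster (zdGraph 2) (spinSites 1 (badConfig p)) t).Infinite} := by
  classical
  rw [measurableSet_prodTailEvents_iff]
  intro Λ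
  have heq : {p : SpinConfig (Site 2) × SpinConfig (Site 2) | ∃ t, (siteCluster (zdGraph 2) (spinSites 1 (badConfig p)) t).Infinite} =
      badConfigOff Λ ⁻¹' existsInfCluster (zdGraph 2) 1 := by
    ext p
    simp only [Set.mem_setOf_eq, Set.mem_preimage, mem_existsInfCluster_iff, spinSites_badConfigOff]
    constructor
    · rintro ⟨t, ht⟩
      obtain ⟨z, -, -, hz, -⟩ := exists_infinite_siteCluster_sdiff ht Λ
      exact ⟨z, hz⟩
    · rintro ⟨t, ht⟩
      exact ⟨t, ht.mono (siteCluster_mono Set.sdiff_subset t)⟩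
  rw [heq]
  exact measurable_badConfigOff Λ (measurableSet_existsInfCluster (G := zdGraph 2) 1)

/-- The event is measurable. [folklore] -/
theorem measurableSet_existsInfBadCluster :
    MeasurableSet {p : SpinConfig (Site 2) × SpinConfig (Site 2) |
      ∃ t, (siteCluster (zdGraph 2) (spinSites 1 (badConfig p)) t).Infinite} :=
  MeasurableSet.of_prodTailEvents measurableSet_prodTailEvents_existsInfBadCluster

/-- **Zero–one law for bad percolation in the duplicated system** of two tail-trivial measures. [cite: GeorgiiHiguchi2000, Lemma 5.5 (proof, p. 16)] -/
theorem measure_existsInfBadCluster_eq_zero_or_one {μ μ' : Measure (SpinConfig (Site 2))} [SFinite μ] [SFinite μ']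
    (hμt : IsTailTrivial μ) (hμ't : IsTailTrivial μ') :
    μ.prod μ' {p | ∃ t, (siteCluster (zdGraph 2) (spinSites 1 (badConfig p)) t).Infinite} = 0 ∨
      μ.prod μ' {p | ∃ t, (siteCluster (zdGraph 2) (spinSites 1 (badConfig p)) t).Infinite} = 1 :=
  hμt.prod hμ't measurableSet_prodTailEvents_existsInfBadCluster

/-- **No bad percolation from a positive probability of its absence** ("with probability at least
`(θ/4)⁴` each finite set is surrounded by a `≤∗`circuit … the lemma follows"). [cite: GeorgiiHiguchi2000, Lemma 5.5 (proof, p. 16)] -/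
theorem ae_no_bad_percolation_of_measure_compl_ne_zero {μ μ' : Measure (SpinConfig (Site 2))}
    [IsProbabilityMeasure μ] [IsProbabilityMeasure μ'] (hμt : IsTailTrivial μ) (hμ't : IsTailTrivial μ')
    (hpos : μ.prod μ' {p | ∀ t, ¬ (siteCluster (zdGraph 2) (spinSites 1 (badConfig p)) t).Infinite} ≠ 0) :
    ∀ᵐ p ∂(μ.prod μ'), ∀ t, ¬ (siteCluster (zdGraph 2) (spinSites 1 (badConfig p)) t).Infinite := by
  rw [ae_iff]
  have hset : {p : SpinConfig (Site 2) × SpinConfig (Site 2) | ¬ ∀ t, ¬ (siteCluster (zdGraph 2) (spinSites 1 (badConfig p)) t).Infinite} =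
      {p | ∃ t, (siteCluster (zdGraph 2) (spinSites 1 (badConfig p)) t).Infinite} := by
    ext p; simp
  rw [hset]
  rcases measure_existsInfBadCluster_eq_zero_or_one hμt hμ't with h | h
  · exact h
  · exfalso
    apply hpos
    have hcompl : {p : SpinConfig (Site 2) × SpinConfig (Site 2) | ∀ t, ¬ (siteCluster (zdGraph 2) (spinSites 1 (badConfig p)) t).Infinite} =
        {p | ∃ t, (siteCluster (zdGraph 2) (spinSites 1 (badConfig p)) t).Infinite}ᶜ := by
      ext p; simp
    rw [hcompl, prob_compl_eq_zero_iff measurableSet_existsInfBadCluster]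
    exact h

end Tail

/-! ### Positive correlations in the duplicated system -/

section Correlations

variable {β : ℝ} {μ μ' : Measure (SpinConfig (Site 2))}

/-- **`ν̂(A ∩ B) ≥ ν̂(A) ν̂(B)` for events increasing in `ω̂` and decreasing in `ω`**
(Georgii–Higuchi 2000, end of the proof of Lemma 5.5: "using the positive correlations of `μ̂`
and `μ`"), for tail-trivial `μ, μ̂ ∈ 𝒢(β, 0)`. [cite: GeorgiiHiguchi2000, Lemma 5.5 (proof, p. 16)] -/
theorem prod_measureReal_inter_ge (hβ : 0 ≤ β) (hμ : μ ∈ isingGibbsMeasures 2 β 0) (hμ' : μ' ∈ isingGibbsMeasures 2 β 0)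
    (hμt : IsTailTrivial μ) (hμ't : IsTailTrivial μ')
    {A B : Set (SpinConfig (Site 2) × SpinConfig (Site 2))} (hAm : MeasurableSet A) (hBm : MeasurableSet B)
    (hA1 : ∀ ω ω₁ ω', ω₁ ≤ ω → (ω, ω') ∈ A → (ω₁, ω') ∈ A) (hA2 : ∀ ω ω' ω₂', ω' ≤ ω₂' → (ω, ω') ∈ A → (ω, ω₂') ∈ A)
    (hB1 : ∀ ω ω₁ ω', ω₁ ≤ ω → (ω, ω') ∈ B → (ω₁, ω') ∈ B) (hB2 : ∀ ω ω' ω₂', ω' ≤ ω₂' → (ω, ω') ∈ B → (ω, ω₂') ∈ B) :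
    (μ.prod μ').real A * (μ.prod μ').real B ≤ (μ.prod μ').real (A ∩ B) := by
  have hμG : IsGibbsMeasure (isingSpecification (zdGraph 2) β 0) μ := hμ
  have hμG' : IsGibbsMeasure (isingSpecification (zdGraph 2) β 0) μ' := hμ'
  haveI := hμG.isProbabilityMeasure
  haveI := hμG'.isProbabilityMeasure
  -- the section probabilities `F(ω) = μ'(A_ω)`, `G(ω) = μ'(B_ω)` are antitone in `ω`
  set F : SpinConfig (Site 2) → ℝ := fun ω => μ'.real (Prod.mk ω ⁻¹' A) with hF
  set G : SpinConfig (Site 2) → ℝ := fun ω => μ'.real (Prod.mk ω ⁻¹' B) with hG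
  have hFm : Measurable F := (measurable_measure_prodMk_left hAm).ennreal_toReal
  have hGm : Measurable G := (measurable_measure_prodMk_left hBm).ennreal_toReal
  have hFanti : Antitone F := fun ω ω₁ hle => measureReal_mono (fun ω' h => hA1 ω₁ ω ω' hle h)
  have hGanti : Antitone G := fun ω ω₁ hle => measureReal_mono (fun ω' h => hB1 ω₁ ω ω' hle h)
  -- inner FKG for `μ'`: `μ'(A_ω ∩ B_ω) ≥ μ'(A_ω) μ'(B_ω)`
  have hinner : ∀ ω, F ω * G ω ≤ μ'.real (Prod.mk ω ⁻¹' (A ∩ B)) := by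
    intro ω
    have hAω : MeasurableSet (Prod.mk ω ⁻¹' A) := measurable_prodMk_left hAm
    have hBω : MeasurableSet (Prod.mk ω ⁻¹' B) := measurable_prodMk_left hBm
    have hmA : Monotone ((Prod.mk ω ⁻¹' A).indicator (1 : SpinConfig (Site 2) → ℝ)) :=
      monotone_indicator_one_of_isUpperSet fun ω' ω₂' hle h => hA2 ω ω' ω₂' hle h
    have hmB : Monotone ((Prod.mk ω ⁻¹' B).indicator (1 : SpinConfig (Site 2) → ℝ)) :=
      monotone_indicator_one_of_isUpperSet fun ω' ω₂' hle h => hB2 ω ω' ω₂' hle h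
    have h := isingGibbs_integral_mul_ge_of_isTailTrivial hβ hμ' hμ't hmA hmB
      (measurable_one.indicator hAω) (measurable_one.indicator hBω) (Cf := 1) (Cg := 1)
      (fun σ => by by_cases hσ : σ ∈ Prod.mk ω ⁻¹' A <;> simp [hσ])
      (fun σ => by by_cases hσ : σ ∈ Prod.mk ω ⁻¹' B <;> simp [hσ])
    rw [integral_indicator_one hAω, integral_indicator_one hBω] at h
    have hprod : (fun σ => (Prod.mk ω ⁻¹' A).indicator (1 : SpinConfig (Site 2) → ℝ) σ * (Prod.mk ω ⁻¹' B).indicator 1 σ) =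
        (Prod.mk ω ⁻¹' (A ∩ B)).indicator 1 := by
      funext σ
      by_cases h1 : σ ∈ Prod.mk ω ⁻¹' A <;> by_cases h2 : σ ∈ Prod.mk ω ⁻¹' B <;>
        simp [h1, h2, Set.indicator_of_mem, Set.indicator_of_notMem, Set.preimage_inter]
    rw [hprod, integral_indicator_one (measurable_prodMk_left (hAm.inter hBm))] at h
    exact h
  -- outer FKG for `μ` with the antitone `F`, `G` (apply FKG to `-F`, `-G`)
  have houter : (∫ ω, F ω ∂μ) * (∫ ω, G ω ∂μ) ≤ ∫ ω, F ω * G ω ∂μ := by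
    have h := isingGibbs_integral_mul_ge_of_isTailTrivial hβ hμ hμt (f := fun ω => -F ω) (g := fun ω => -G ω)
      (fun a b hab => neg_le_neg (hFanti hab)) (fun a b hab => neg_le_neg (hGanti hab)) hFm.neg hGm.neg (Cf := 1) (Cg := 1)
      (fun σ => by rw [abs_neg, hF, abs_of_nonneg measureReal_nonneg]; exact measureReal_le_one)
      (fun σ => by rw [abs_neg, hG, abs_of_nonneg measureReal_nonneg]; exact measureReal_le_one)
    simp only [integral_neg, neg_mul_neg] at h
    exact h
  -- Fubini
  have hsec : ∀ {C : Set (SpinConfig (Site 2) × SpinConfig (Site 2))}, MeasurableSet C →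
      (μ.prod μ').real C = ∫ ω, μ'.real (Prod.mk ω ⁻¹' C) ∂μ := by
    intro C hC
    rw [measureReal_def, Measure.prod_apply hC, integral_eq_lintegral_of_nonneg_ae
      (Eventually.of_forall fun ω => measureReal_nonneg) (measurable_measure_prodMk_left hC).ennreal_toReal.aestronglyMeasurable]
    congr 1
    refine lintegral_congr fun ω => ?_
    rw [measureReal_def, ENNReal.ofReal_toReal (measure_ne_top _ _)]
  rw [hsec hAm, hsec hBm, hsec (hAm.inter hBm)]
  refine houter.trans (integral_mono_of_nonneg (Eventually.of_forall fun ω => mul_nonneg measureReal_nonneg measureReal_nonneg)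
    ?_ (Eventually.of_forall hinner))
  exact Integrable.of_bound (measurable_measure_prodMk_left (hAm.inter hBm)).ennreal_toReal.aestronglyMeasurable 1
    (Eventually.of_forall fun ω => by rw [Real.norm_eq_abs, abs_of_nonneg measureReal_nonneg]; exact measureReal_le_one)

end Correlations

/-! ### The translation-invariance criterion -/

section Criterion

variable {β : ℝ} {μ : Measure (SpinConfig (Site 2))}

/-- The shifted measure `μ ∘ ϑ_v⁻¹` is a Gibbs measure. [cite: GeorgiiHiguchi2000, §2 p. 3] -/
theorem map_configRelabel_shift_mem_isingGibbsMeasures (hμ : μ ∈ isingGibbsMeasures 2 β 0) (v : Site 2) :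
    μ.map (configRelabel (Site.shift v)) ∈ isingGibbsMeasures 2 β 0 := by
  have hμG : IsGibbsMeasure (isingSpecification (zdGraph 2) β 0) μ := hμ
  exact IsGibbsMeasure.map_configRelabel _ (zdShiftIso v) hμG

/-- **Translation invariance from the absence of bad percolation** (Georgii–Higuchi 2000,
Prop. 5.1 via Lemma 5.5 and the argument of p. 16): a Gibbs measure `μ ∈ 𝒢(β, 0)` on `ℤ²` is
invariant under all translations as soon as, for each of the two unit shifts `ϑ`, the duplicated
systems `μ ⊗ (μ ∘ ϑ⁻¹)` and `(μ ∘ ϑ⁻¹) ⊗ μ` almost surely have no infinite lattice cluster of bad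
sites. [cite: GeorgiiHiguchi2000, Prop. 5.1 (proof)] -/
theorem isTranslationInvariantMeasure_of_no_bad_percolation (hβ : 0 ≤ β) (hμ : μ ∈ isingGibbsMeasures 2 β 0)
    (h : ∀ i : Fin 2,
      (∀ᵐ p ∂(μ.prod (μ.map (configRelabel (Site.shift (Pi.single i 1 : Site 2))))),
        ∀ t, ¬ (siteCluster (zdGraph 2) (spinSites 1 (badConfig p)) t).Infinite) ∧
      (∀ᵐ p ∂((μ.map (configRelabel (Site.shift (Pi.single i 1 : Site 2)))).prod μ),
        ∀ t, ¬ (siteCluster (zdGraph 2) (spinSites 1 (badConfig p)) t).Infinite)) :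
    IsTranslationInvariantMeasure μ := by
  intro v
  change μ.map (configRelabel (Site.shift v)) = μ
  refine map_configRelabel_shift_eq_of_generators (fun i => ?_) v
  obtain ⟨hT, hT'⟩ := h i
  exact (eq_of_no_bad_percolation hβ hμ (map_configRelabel_shift_mem_isingGibbsMeasures hμ _) hT hT').symm

end Criterion

end Literature.Probability.LatticeModels
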